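import Mathlib.AlgebraicGeometry.Morphisms.Smooth
import Literature.AlgebraicGeometry.HodgeTheory.RationalHodgeClasses
import Literature.AlgebraicGeometry.HodgeTheory.GysinFormalism
import Literature.AlgebraicGeometry.Motives.BaseChange
import Literature.Geometry.Kaehler.ComplexTorusHodge
import Literature.Geometry.Kaehler.HolomorphicLineBundle
import HarnessLib

/-!
# Absolute Hodge classes on a smooth projective complex variety (real carriers)

For `X` smooth projective over `ℂ`, `σ ∈ Aut ℂ` and the conjugate variety `X^σ = X ×_{ℂ,σ} ℂ`
(`Motives.conjugateVariety σ X`), Charles–Schnell (Def. 11.2.3) call a class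
`α ∈ H²ᵖ(X^an, ℚ(p)) ⊂ H²ᵖ(X^an, ℂ) ≅ H²ᵖ_dR(X/ℂ)` **absolute Hodge** if for every `σ` its conjugate
`α^σ ∈ H²ᵖ_dR(X^σ/ℂ) ≅ H²ᵖ((X^σ)^an, ℂ)` — transported along the `σ`-linear isomorphism
`(σ⁻¹)^* : H_dR(X/ℂ) ⥲ H_dR(X^σ/ℂ)` of ALGEBRAIC de Rham cohomology (their (11.2.2)–(11.2.3)) — is again
(the image of) a rational Hodge class; Deligne 1982, §2 (Def. 2.10 with the `ℓ`-adic components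
omitted, cf. Charles–Schnell Remark after Def. 11.2.5); Voisin 2007, Def. 1.1, and Def. 2.1 for the
WEAK variant (`α^σ` proportional to a rational class). This file defines these notions on the tree's
real carriers `complexBetti X k = Hᵏ(X(ℂ); ℂ)`, `IsRationalClass`, `IsOfHodgeType`:

* `IsConjugateClass σ X k c c'` — `c' ∈ Hᵏ(X^σ(ℂ); ℂ)` is THE `σ`-conjugate of `c ∈ Hᵏ(X(ℂ); ℂ)`;
* `periodTwist σ p = (2πi / σ(2πi))ᵖ` — the factor by which conjugation moves `ℚ(p)`-classes read in
  untwisted lattices (`[Z] ↦ (2πi/σ(2πi))ᵖ [Z^σ]` for an algebraic cycle `Z`);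
* `IsAbsoluteHodgeClass n X p c`, `IsWeaklyAbsoluteHodgeClass n X p c`.

## How the conjugate class is pinned down without a constructed comparison theorem

Neither Mathlib nor the tree has algebraic de Rham cohomology of schemes (no algebraic de Rham
complex, no hypercohomology), and an axiomatised comparison datum (as in the hypothesis structure
`Motives.PeriodRealization`) does NOT determine `α^σ`: composing a comparison with a natural
automorphism of `H_B ⊗ ℂ` (e.g. the Deligne torus acting by `e^{i(q-p)θ}` on `H^{p,q}`) preserves every
axiom. We therefore go through smooth AFFINE varieties, where algebraic de Rham cohomology needs no
hypercohomology: for `Y = Spec A` smooth over `ℂ`, `Hᵏ_dR(Y/ℂ) = Hᵏ(Ω•_{A/ℂ})` and every algebraic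
`k`-form is a finite sum `∑ⱼ fⱼ dg_{j,1} ∧ ⋯ ∧ dg_{j,k}` with `fⱼ, g_{j,i} ∈ A = Γ(Y, 𝒪)`
(Grothendieck 1966, Thm. 1'); such an expression (`AlgFormExpr`) is realised as a smooth complex
form on an analytification `Y^an` (`AlgFormExpr.realize`: regular functions pull back to holomorphic
functions, `IsAnalytification`; `d` and `∧` are the tree's `mextDeriv`, `MForm.wedge`), and its
conjugate is the same expression with `fⱼ, g_{j,i}` replaced by their images under the ring
isomorphism `Γ(Y, 𝒪) ≅ Γ(Y^σ, 𝒪)` (pull-back along the projection `Y^σ → Y`, an isomorphism of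
abstract schemes; Charles–Schnell (11.2.2)). For `X` smooth projective one uses any smooth affine `Y`
with a `ℂ`-morphism `π : Y ⟶ X` such that `(π^σ)^*` is injective on `Hᵏ` — Jouanolou's device
(Jouanolou 1973, Lemme 1.5: an affine torsor under a vector bundle, so `π^*`, `(π^σ)^*` are
isomorphisms) shows such `Y` exist — and functoriality of conjugation and comparison,
`θ_σ ∘ π^* = (π^σ)^* ∘ θ_σ`, forces `c' = θ_σ(c)`. All this data is the structure `ConjugationChart`,
and `IsConjugateClass` quantifies `∃` over charts.

**Junk analysis.** (1) Every chart computes the canonical conjugate: the analytification of a smooth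
`Y` is unique up to biholomorphism over `Y(ℂ)` (`IsAnalytification.unique`), realisation of
expressions commutes with biholomorphisms over `Y(ℂ)`, and on a smooth affine `Y` closed algebraic
forms compute `Hᵏ(Y^an; ℂ)` compatibly with conjugation (Grothendieck 1966; Charles–Schnell §11.2.2).
(2) The de Rham isomorphism must be the integration isomorphism UP TO `ℚˣ`: conjugation is
`σ`-semilinear, so rescaling `H^k_dR ≃ Hᵏ` by `λ ∈ ℂˣ` rescales `c'` by `λ/σ(λ)`. A natural family
(`ComplexDeRhamIsoFamily.IsNatural`) is `c_k ·`(integration) on `Hᵏ` of all manifolds charted on `E`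
(Thom realisation: classes `f_*[P]`, `P` a closed oriented `k`-manifold, span `H_k(–; ℚ)`, and
degree-one maps `P → Sᵏ` compare the scalars; as in the docstring of `RationalHodgeClasses`), and
`IsRationalDeRhamFamily e k` (constant forms on complex tori with rational values on lattice
`k`-tuples have rational classes — true for integration, whose periods on the sub-tori are these
values) forces `c_k ∈ ℚˣ`, which cancels. The SAME family serves `Y^an` and `(Y^σ)^an` (both charted
on `E`). (3) `∃` over charts is therefore single-valued; it is non-vacuous for smooth projective `X`
by Jouanolou + GAGA (`exists_isAnalytification`) + de Rham's theorem + Grothendieck's comparison —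
theorems not yet in the tree, which is why `IsAbsoluteHodgeClass` also RECORDS existence of the
conjugate as a conjunct (so that it cannot hold vacuously) and why no class can presently be PROVED
absolute Hodge: the first consumer theorem to formalise is "cycle classes are absolute Hodge"
(Charles–Schnell §11.2.2; Deligne 1982, Ex. 2.1(a)).

Not here: algebraic de Rham cohomology itself, Principle B, the `ℓ`-adic components of Deligne's
original definition, Hodge loci (Voisin 2007 §2; Charles–Schnell §11.3).

## References

* F. Charles, C. Schnell, *Notes on absolute Hodge classes*, in *Hodge Theory*, Math. Notes 49
  (2014), §11.2.2, Def. 11.2.3–11.2.4 (PDF pp. 464–466), §11.3.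
* P. Deligne, *Hodge cycles on abelian varieties*, LNM 900 (1982), §2.
* C. Voisin, *Hodge loci and absolute Hodge classes*, Compositio 143 (2007), Def. 1.1, Def. 2.1, Rem. 2.2.
* A. Grothendieck, *On the de Rham cohomology of algebraic varieties*, Publ. IHÉS 29 (1966), Thm. 1'.
* J.-P. Jouanolou, *Une suite exacte de Mayer–Vietoris en K-théorie algébrique*, LNM 341 (1973), Lemme 1.5.
-/

noncomputable section

open scoped Manifold ContDiff
open CategoryTheory AlgebraicGeometry
open Literature.NumberTheory.Transcendental Literature.Geometry.Kaehler
open Literature.AlgebraicTopology.SingularHomology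

namespace Literature.AlgebraicGeometry.HodgeTheory

section HodgeTheory

/-! ### Iterated differentials `dg₁ ∧ ⋯ ∧ dg_k` of functions on a manifold -/

section Forms

variable {E : Type*} [NormedAddCommGroup E] [NormedSpace ℂ E]
  {M : Type*} [TopologicalSpace M] [ChartedSpace E M]

/-- The differential `dg` of a complex function on a manifold charted on a complex normed space, as a
complex `1`-form (`mextDeriv` of the `0`-form `MForm.ofFun`). [folklore] -/
def dFun (g : M → ℂ) : MForm 𝓘(ℝ, E) M ℂ 1 :=
  mextDeriv (MForm.ofFun 𝓘(ℝ, E) g)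

/-- The `k`-form `dg₀ ∧ dg₁ ∧ ⋯ ∧ dg_{k-1}` of a `k`-tuple of complex functions (`1` for `k = 0`),
by recursion on `k` with the tree's pointwise wedge `MForm.wedge`. [folklore] -/
def dWedge : (k : ℕ) → (Fin k → (M → ℂ)) → MForm 𝓘(ℝ, E) M ℂ k
  | 0, _ => MForm.ofFun 𝓘(ℝ, E) fun _ ↦ (1 : ℂ)
  | k + 1, g => ((dFun (g 0)).wedge (dWedge k (Fin.tail g))).castDeg (Nat.add_comm 1 k)

end Forms

/-! ### Analytifications charted on a fixed model space -/

/-- An **analytic model** of a smooth `ℂ`-scheme `Y` of dimension `m`, charted on the complex model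
space `E`: a Hausdorff σ-compact complex manifold `carrier` with holomorphic atlas valued in `E` and a
map `toComplexPoints : carrier → Y(ℂ)` which is the analytification of `Y`
(`IsAnalytification`: homeomorphism, `dim E = m`, regular functions pull back to holomorphic ones;
unique up to unique biholomorphism over `Y(ℂ)`, `IsAnalytification.unique`). This is `HodgeModel`
without the de Rham family and the Hodge decomposition (affine `Y` are needed here).
[cite: SerreGAGA1956, §2] -/
structure AnalyticModel (E : Type) [NormedAddCommGroup E] [NormedSpace ℂ E] [FiniteDimensional ℂ E]
    (m : ℕ) (Y : Motives.SchemeOver ℂ) : Type 1 where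
  /-- The underlying set of `Y^an`. [cite: SerreGAGA1956, §2] -/
  carrier : Type
  /-- The analytic topology. [cite: SerreGAGA1956, §2] -/
  [topologicalSpace : TopologicalSpace carrier]
  /-- The atlas, valued in `E`. [cite: SerreGAGA1956, §2] -/
  [chartedSpace : ChartedSpace E carrier]
  /-- The atlas is holomorphic. [cite: SerreGAGA1956, §2] -/
  [isManifold : IsManifold 𝓘(ℂ, E) ω carrier]
  /-- The underlying real `C^∞` structure. [cite: WellsDACM1980, Ch. I §3] -/
  [isManifold_real : IsManifold 𝓘(ℝ, E) ∞ carrier]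
  /-- `Y^an` is Hausdorff (for `Y` separated). [cite: SerreGAGA1956, §2] -/
  [t2Space : T2Space carrier]
  /-- `Y^an` is σ-compact (for `Y` of finite type). [cite: SerreGAGA1956, §2] -/
  [sigmaCompactSpace : SigmaCompactSpace carrier]
  /-- The comparison map `Y^an → Y(ℂ)`. [cite: SerreGAGA1956, §2] -/
  toComplexPoints : carrier → Motives.ComplexPoints Y
  /-- `toComplexPoints` is the analytification of `Y`. [cite: SerreGAGA1956, §2] -/
  isAnalytification : IsAnalytification E Y m toComplexPoints

namespace AnalyticModel

attribute [instance] topologicalSpace chartedSpace isManifold isManifold_real t2Space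
  sigmaCompactSpace

variable {E : Type} [NormedAddCommGroup E] [NormedSpace ℂ E] [FiniteDimensional ℂ E] {m : ℕ}
  {Y : Motives.SchemeOver ℂ} (A : AnalyticModel E m Y)

/-- Pull-back `Hᵏ(Y(ℂ); ℂ) ⟶ Hᵏ(Y^an; ℂ)` along the (homeomorphic) comparison map. [cite: SerreGAGA1956, §2] -/
abbrev pullback (k : ℕ) :
    singularCohomology ℂ ℂ (Motives.ComplexPoints Y) k ⟶ singularCohomology ℂ ℂ A.carrier k :=
  singularCohomology.map ℂ ℂ ⟨A.toComplexPoints, A.isAnalytification.isHomeomorph.continuous⟩ k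

/-- A global regular function `s ∈ Γ(Y, 𝒪)` as a complex function on `Y^an` (holomorphic, by
`isAnalytification`, when `Y` is affine). [cite: SerreGAGA1956, §2] -/
def regularFun (s : Γ(Y.left, ⊤)) : A.carrier → ℂ :=
  fun x ↦ Motives.AlgPoints.evalOrZero ⊤ s (A.toComplexPoints x)

end AnalyticModel

/-! ### Algebraic differential forms as expressions, their realisation and conjugation -/

/-- An **algebraic `k`-form expression** on a `ℂ`-scheme `Y`: the formal finite sum
`∑_{j < size} coef j · d(arg j 0) ∧ ⋯ ∧ d(arg j (k-1))` with `coef j, arg j i ∈ Γ(Y, 𝒪)`. For `Y = Spec A`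
affine these present all of `Ωᵏ_{A/ℂ} = ⋀ᵏ Ω¹_{A/ℂ}` (`Ω¹` is generated by the `dg`).
[cite: Grothendieck1966, Thm. 1'] -/
structure AlgFormExpr (Y : Motives.SchemeOver ℂ) (k : ℕ) where
  /-- Number of monomials. [folklore] -/
  size : ℕ
  /-- Coefficient of the `j`-th monomial. [folklore] -/
  coef : Fin size → Γ(Y.left, ⊤)
  /-- The functions differentiated in the `j`-th monomial. [folklore] -/
  arg : Fin size → Fin k → Γ(Y.left, ⊤)

namespace AlgFormExpr

variable {Y : Motives.SchemeOver ℂ} {k : ℕ}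

/-- The smooth complex `k`-form on an analytic model `Y^an` presented by an expression:
`∑ⱼ (coef j ∘ φ) · d(arg j 0 ∘ φ) ∧ ⋯`, `φ : Y^an → Y(ℂ)`; closed algebraic forms realised this way
compute `Hᵏ(Y^an; ℂ)` for `Y` smooth affine (Grothendieck's comparison theorem).
[cite: Grothendieck1966, Thm. 1'] -/
def realize {E : Type} [NormedAddCommGroup E] [NormedSpace ℂ E] [FiniteDimensional ℂ E] {m : ℕ}
    (ξ : AlgFormExpr Y k) (A : AnalyticModel E m Y) : MForm 𝓘(ℝ, E) A.carrier ℂ k :=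
  ∑ j : Fin ξ.size, fun x ↦ A.regularFun (ξ.coef j) x • dWedge k (fun i ↦ A.regularFun (ξ.arg j i)) x

/-- The **conjugate expression** on `Y^σ`: apply the ring isomorphism `Γ(Y, 𝒪) → Γ(Y^σ, 𝒪)`
(pull-back along the projection `Y^σ → Y`, Charles–Schnell's `σ⁻¹`, an isomorphism of abstract
schemes) to all coefficients and arguments — the map `α ↦ α^σ` of (11.2.2) on presentations.
[cite: CharlesSchnell2014Notes, §11.2.2 (11.2.2)] -/
def conj (σ : ℂ ≃+* ℂ) (ξ : AlgFormExpr Y k) : AlgFormExpr (Motives.conjugateVariety σ Y) k where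
  size := ξ.size
  coef j := (Motives.baseChangeHomFst σ.toRingHom Y).appTop (ξ.coef j)
  arg j i := (Motives.baseChangeHomFst σ.toRingHom Y).appTop (ξ.arg j i)

end AlgFormExpr

/-- The conjugate `π^σ : Y^σ ⟶ X^σ` of a `ℂ`-morphism `π : Y ⟶ X` (base change along `σ`; typed with
`Motives.conjugateVariety`, to which `(baseChangeHom σ).obj` is definitionally equal).
[cite: CharlesSchnell2014Notes, §11.2.2 (11.2.1)] -/
abbrev conjHom (σ : ℂ ≃+* ℂ) {Y X : Motives.SchemeOver ℂ} (π : Y ⟶ X) :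
    Motives.conjugateVariety σ Y ⟶ Motives.conjugateVariety σ X :=
  (Motives.baseChangeHom σ.toRingHom).map π

/-! ### Normalised de Rham families and conjugation charts -/

/-- A complex de Rham isomorphism family `e` is **rationally normalised in degree `k`** if, on every
complex torus `E/Φ(ℤ^ι)` charted on `E`, the class of a constant `k`-form taking rational values on
all `k`-tuples of lattice basis vectors is a rational class in `Hᵏ(–; ℂ)`. The integration
isomorphism has this property (its periods on the coordinate sub-tori are exactly these values);
with naturality it pins `e` down to a rational multiple of integration in degree `k` (module
docstring, junk analysis (2)). [cite: BottTu1982Forms, §I.5] -/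
def IsRationalDeRhamFamily {E : Type} [NormedAddCommGroup E] [NormedSpace ℂ E]
    (e : ComplexDeRhamIsoFamily E) (k : ℕ) : Prop :=
  ∀ (ι : Type) [Fintype ι] [DecidableEq ι] (Φ : (ι → ℝ) ≃L[ℝ] E) (a : E [⋀^Fin k]→L[ℝ] ℂ),
    (∀ v : Fin k → ι, a (fun j ↦ Φ (Pi.single (v j) 1)) ∈ Set.range (algebraMap ℚ ℂ)) →
      IsRationalClass (e (ComplexTorus Φ) k (ComplexTorus.cconstClass Φ a))

/-- A **conjugation chart** for `(σ, X, k)`: a smooth affine `Y` of dimension `m` with a `ℂ`-morphism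
`π : Y ⟶ X` whose conjugate `π^σ : Y^σ ⟶ X^σ` is injective on `Hᵏ(–(ℂ); ℂ)` (Jouanolou's affine
vector-bundle torsor over a projective `X` is one, with `π^*`, `(π^σ)^*` bijective), analytic models
of `Y` and `Y^σ` charted on one model space `E`, and one natural, rationally normalised complex
de Rham family on `E`-manifolds. [cite: Jouanolou1973, Lemme 1.5] -/
structure ConjugationChart (σ : ℂ ≃+* ℂ) (X : Motives.SchemeOver ℂ) (k : ℕ) : Type 1 where
  /-- Dimension of the affine variety `Y`. [folklore] -/
  m : ℕ
  /-- The smooth affine `ℂ`-scheme `Y`. [cite: Jouanolou1973, Lemme 1.5] -/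
  Y : Motives.SchemeOver ℂ
  /-- The structure morphism `π : Y ⟶ X` over `ℂ`. [cite: Jouanolou1973, Lemme 1.5] -/
  π : Y ⟶ X
  /-- `Y` is affine. [cite: Jouanolou1973, Lemme 1.5] -/
  [isAffine : IsAffine Y.left]
  /-- `Y` is smooth over `ℂ` of relative dimension `m`. [cite: Jouanolou1973, Lemme 1.5] -/
  [smooth : SmoothOfRelativeDimension m Y.hom]
  /-- The common complex model space of the two analytifications. [cite: SerreGAGA1956, §2] -/
  E : Type
  /-- `E` is a complex normed space … [folklore] -/
  [normedAddCommGroup : NormedAddCommGroup E]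
  /-- … over `ℂ` … [folklore] -/
  [normedSpace : NormedSpace ℂ E]
  /-- … of finite dimension (`= m`). [folklore] -/
  [finiteDimensional : FiniteDimensional ℂ E]
  /-- An analytic model of `Y`. [cite: SerreGAGA1956, §2] -/
  an : AnalyticModel E m Y
  /-- An analytic model of the conjugate `Y^σ` (smooth affine of the same dimension).
  [cite: CharlesSchnell2014Notes, §11.2.2 (11.2.1)] -/
  anConj : AnalyticModel E m (Motives.conjugateVariety σ Y)
  /-- A complex de Rham isomorphism family on manifolds charted on `E`. [cite: WellsDACM1980, Thm. III.4.13] -/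
  deRham : ComplexDeRhamIsoFamily E
  /-- The family is natural for `C^∞` maps. [cite: BottTu1982Forms, §I.5] -/
  deRham_isNatural : deRham.IsNatural
  /-- The family is rationally normalised in degree `k`. [cite: BottTu1982Forms, §I.5] -/
  deRham_isRational : IsRationalDeRhamFamily deRham k
  /-- `(π^σ)^* : Hᵏ(X^σ(ℂ); ℂ) → Hᵏ(Y^σ(ℂ); ℂ)` is injective. [cite: Jouanolou1973, Lemme 1.5] -/
  injective_map : Function.Injective (complexBetti.map (conjHom σ π) k)

namespace ConjugationChart

attribute [instance] isAffine smooth normedAddCommGroup normedSpace finiteDimensional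

variable {σ : ℂ ≃+* ℂ} {X : Motives.SchemeOver ℂ} {k : ℕ} (D : ConjugationChart σ X k)

/-- In the chart `D`, `c' ∈ Hᵏ(X^σ(ℂ); ℂ)` **is conjugate to** `c ∈ Hᵏ(X(ℂ); ℂ)`: some closed algebraic
form expression `ξ` on `Y` represents `π^* c` on `Y^an` (through the de Rham isomorphism), and its
conjugate expression `ξ^σ` represents `(π^σ)^* c'` on `(Y^σ)^an`. This is Charles–Schnell's
`α ↦ α^σ` ((11.2.2)–(11.2.3), de Rham conjugation, read in singular cohomology through the
comparison isomorphisms) computed on the affine `Y`. [cite: CharlesSchnell2014Notes, §11.2.2 (11.2.3)] -/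
def Conjugates (c : complexBetti X k) (c' : complexBetti (Motives.conjugateVariety σ X) k) : Prop :=
  ∃ (ξ : AlgFormExpr D.Y k) (hξ : ξ.realize D.an ∈ cclosedSmoothForms D.E D.an.carrier k)
    (hξ' : (ξ.conj σ).realize D.anConj ∈ cclosedSmoothForms D.E D.anConj.carrier k),
    D.an.pullback k (complexBetti.map D.π k c) =
        D.deRham D.an.carrier k (complexDeRhamCohomology.mk D.E D.an.carrier k ⟨_, hξ⟩) ∧
      D.anConj.pullback k (complexBetti.map (conjHom σ D.π) k c') =
        D.deRham D.anConj.carrier k (complexDeRhamCohomology.mk D.E D.anConj.carrier k ⟨_, hξ'⟩)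

/-- The empty expression realises the zero form. [folklore] -/
theorem realize_of_size_zero {Z : Motives.SchemeOver ℂ} {E : Type} [NormedAddCommGroup E]
    [NormedSpace ℂ E] [FiniteDimensional ℂ E] {m : ℕ} (ξ : AlgFormExpr Z k) (hξ : ξ.size = 0)
    (A : AnalyticModel E m Z) : ξ.realize A = 0 := by
  unfold AlgFormExpr.realize
  have : IsEmpty (Fin ξ.size) := by rw [hξ]; infer_instance
  exact Finset.sum_of_isEmpty _

/-- In every chart, `0` is conjugate to `0` (the empty expression). [folklore] -/
theorem conjugates_zero : D.Conjugates 0 0 := by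
  let ξ : AlgFormExpr D.Y k := ⟨0, Fin.elim0, Fin.elim0⟩
  have h₁ : ξ.realize D.an = 0 := realize_of_size_zero ξ rfl D.an
  have h₂ : (ξ.conj σ).realize D.anConj = 0 := realize_of_size_zero (ξ.conj σ) rfl D.anConj
  refine ⟨ξ, h₁ ▸ Submodule.zero_mem _, h₂ ▸ Submodule.zero_mem _, ?_, ?_⟩
  · have : (⟨ξ.realize D.an, h₁ ▸ Submodule.zero_mem _⟩ : cclosedSmoothForms D.E D.an.carrier k) = 0 :=
      Subtype.ext h₁
    rw [map_zero, map_zero, this, map_zero, map_zero]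
  · have : (⟨(ξ.conj σ).realize D.anConj, h₂ ▸ Submodule.zero_mem _⟩ :
        cclosedSmoothForms D.E D.anConj.carrier k) = 0 :=
      Subtype.ext h₂
    rw [map_zero, map_zero, this, map_zero, map_zero]

end ConjugationChart

variable (σ : ℂ ≃+* ℂ) (X : Motives.SchemeOver ℂ) (k : ℕ) in
/-- `c' ∈ Hᵏ(X^σ(ℂ); ℂ)` **is the `σ`-conjugate** of `c ∈ Hᵏ(X(ℂ); ℂ)`: conjugate in some conjugation
chart. All charts agree and compute Charles–Schnell's `α ↦ α^σ` transported to singular cohomology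
(module docstring, junk analysis); charts exist for `X` smooth projective (Jouanolou 1973, Lemme 1.5
with GAGA, de Rham's and Grothendieck's theorems). [cite: CharlesSchnell2014Notes, §11.2.2 (11.2.3)] -/
def IsConjugateClass (c : complexBetti X k) (c' : complexBetti (Motives.conjugateVariety σ X) k) :
    Prop :=
  ∃ D : ConjugationChart σ X k, D.Conjugates c c'

/-- Given any conjugation chart, `0 ∈ Hᵏ(X^σ(ℂ); ℂ)` is the conjugate of `0`. [folklore] -/
theorem isConjugateClass_zero {σ : ℂ ≃+* ℂ} {X : Motives.SchemeOver ℂ} {k : ℕ}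
    (D : ConjugationChart σ X k) : IsConjugateClass σ X k 0 0 :=
  ⟨D, D.conjugates_zero⟩

/-- The **period twist** `(2πi / σ(2πi))ᵖ ∈ ℂˣ`: conjugation by `σ` sends the cycle class of a
codimension-`p` cycle `Z` to `(2πi/σ(2πi))ᵖ · [Z^σ]` in untwisted lattices, because the comparison
`H²ᵖ(X^an, ℚ(p)) ⊗ ℂ ≅ H²ᵖ_dR` contains the factor `(2πi)^{-p}` (Charles–Schnell, footnote to
Def. 11.2.3; Deligne 1982, §1). [cite: CharlesSchnell2014Notes, Def. 11.2.3 footnote] -/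
def periodTwist (σ : ℂ ≃+* ℂ) (p : ℕ) : ℂ :=
  ((2 * Real.pi * Complex.I) / σ (2 * Real.pi * Complex.I)) ^ p

/-- The identity automorphism has trivial period twist. [folklore] -/
@[simp]
theorem periodTwist_refl (p : ℕ) : periodTwist (RingEquiv.refl ℂ) p = 1 := by
  have h : (2 * Real.pi * Complex.I : ℂ) ≠ 0 := by simp [Real.pi_ne_zero, Complex.I_ne_zero]
  simp [periodTwist, h]

/-- The period twist is a unit of `ℂ` (`σ` is injective and `2πi ≠ 0`). [folklore] -/
theorem periodTwist_ne_zero (σ : ℂ ≃+* ℂ) (p : ℕ) : periodTwist σ p ≠ 0 := by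
  have h : (2 * Real.pi * Complex.I : ℂ) ≠ 0 := by simp [Real.pi_ne_zero, Complex.I_ne_zero]
  have h' : σ (2 * Real.pi * Complex.I) ≠ 0 := fun h0 ↦ h (σ.injective (by rw [h0, map_zero]))
  exact pow_ne_zero _ (div_ne_zero h h')

/-! ### Absolute and weakly absolute Hodge classes -/

variable (n : ℕ) (X : Motives.SchemeOver ℂ) (p : ℕ)

/-- A class `c ∈ H²ᵖ(X(ℂ); ℂ)` on a smooth projective `X/ℂ` of dimension `n` is an **absolute Hodge
class**: it is a rational class of Hodge type `(p, p)`, and for every `σ ∈ Aut ℂ` its `σ`-conjugate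
`c^σ ∈ H²ᵖ(X^σ(ℂ); ℂ)` exists and every such conjugate is `(2πi/σ(2πi))ᵖ` times a rational class of
Hodge type `(p, p)` on `X^σ` — i.e. `α = (2πi)ᵖ c ∈ H²ᵖ(X^an, ℚ(p))` has `α^σ` in the image of the
rational Hodge classes `H²ᵖ((X^σ)^an, ℚ(p)) ∩ F⁰` (Charles–Schnell Def. 11.2.3, de Rham formulation
of Deligne 1982, Def. 2.10; Voisin 2007, Def. 1.1). Existence of the conjugate is a theorem recorded
as a conjunct against vacuity (module docstring (3)). [cite: CharlesSchnell2014Notes, Def. 11.2.3] -/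
def IsAbsoluteHodgeClass (c : complexBetti X (2 * p)) : Prop :=
  IsRationalClass c ∧ IsOfHodgeType n X (2 * p) p p c ∧
    ∀ σ : ℂ ≃+* ℂ,
      (∃ c', IsConjugateClass σ X (2 * p) c c') ∧
        ∀ c', IsConjugateClass σ X (2 * p) c c' →
          ∃ β : complexBetti (Motives.conjugateVariety σ X) (2 * p),
            IsRationalClass β ∧ IsOfHodgeType n (Motives.conjugateVariety σ X) (2 * p) p p β ∧
              c' = periodTwist σ p • β

/-- A class `c ∈ H²ᵖ(X(ℂ); ℂ)` is a **weakly absolute Hodge class** (Voisin 2007, Def. 2.1): as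
`IsAbsoluteHodgeClass`, except that each conjugate is only asked to be `(2πi/σ(2πi))ᵖ · t · β` with
`β` a rational class ("hence a Hodge class": conjugation preserves `Fᵖ`, Charles–Schnell (11.2.3))
of type `(p, p)` and `t ∈ ℂ` algebraic over `ℚ` (Voisin's `λ_σ ∈ ℚ̄`, written after the period twist,
her comparison being the `ℚ(p)`-twisted one of Deligne–Milne; by her Remark 2.2 the algebraicity is
automatic for Hodge classes on projective `X`). [cite: Voisin2007HodgeLoci, Def. 2.1] -/
def IsWeaklyAbsoluteHodgeClass (c : complexBetti X (2 * p)) : Prop :=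
  IsRationalClass c ∧ IsOfHodgeType n X (2 * p) p p c ∧
    ∀ σ : ℂ ≃+* ℂ,
      (∃ c', IsConjugateClass σ X (2 * p) c c') ∧
        ∀ c', IsConjugateClass σ X (2 * p) c c' →
          ∃ (β : complexBetti (Motives.conjugateVariety σ X) (2 * p)) (t : ℂ),
            IsRationalClass β ∧ IsOfHodgeType n (Motives.conjugateVariety σ X) (2 * p) p p β ∧
              IsAlgebraic ℚ t ∧ c' = (periodTwist σ p * t) • β

variable {n X p}

/-- An absolute Hodge class is a rational class. [cite: CharlesSchnell2014Notes, Def. 11.2.3] -/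
theorem IsAbsoluteHodgeClass.isRationalClass {c : complexBetti X (2 * p)}
    (h : IsAbsoluteHodgeClass n X p c) : IsRationalClass c :=
  h.1

/-- An absolute Hodge class is of Hodge type `(p, p)` ("taking `σ = id`, absolute Hodge classes are
Hodge classes"). [cite: CharlesSchnell2014Notes, Def. 11.2.3] -/
theorem IsAbsoluteHodgeClass.isOfHodgeType {c : complexBetti X (2 * p)}
    (h : IsAbsoluteHodgeClass n X p c) : IsOfHodgeType n X (2 * p) p p c :=
  h.2.1

/-- Absolute Hodge classes are weakly absolute Hodge (`t = 1`). [cite: Voisin2007HodgeLoci, Def. 2.1] -/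
theorem IsAbsoluteHodgeClass.isWeaklyAbsoluteHodgeClass {c : complexBetti X (2 * p)}
    (h : IsAbsoluteHodgeClass n X p c) : IsWeaklyAbsoluteHodgeClass n X p c := by
  refine ⟨h.1, h.2.1, fun σ ↦ ⟨(h.2.2 σ).1, fun c' hc' ↦ ?_⟩⟩
  obtain ⟨β, hβ, hβ', rfl⟩ := (h.2.2 σ).2 c' hc'
  exact ⟨β, 1, hβ, hβ', isAlgebraic_one, by rw [mul_one]⟩

end HodgeTheory

end Literature.AlgebraicGeometry.HodgeTheory

end
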